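import Summits.Ventures.LatticeQCDFlow.Scaling.MapStarRotation

/-!
HONEST FRAMING: exact (Metropolis-corrected) sampling algorithms for lattice gauge theory; figures
of merit are autocorrelation/cost numbers at stated couplings and volumes; no continuum-physics
claim.

# DominatedStarRegimeFreeGap — THE SPECTRAL GAP OF THE MAP-ASSISTED HOT-REFRESHED HUB NEEDS NO REGIME: FOR THE CHAPTER-M
# SCHEME `t·GSw + (1−t)·Π_w^M` WITH ENTRY MAPS `φ_r`, ONE-SIDED DOMINATION `p·μ_{κ_r+1}(φ_r u) ≤ μ_0(u)`, A HOT UPDATE OF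
# POINCARÉ CONSTANT `γ₀` AND EVERY COLD LEVEL LISTED `≥ c` TIMES, `Gap ≥ p·min{ct/(3m), γ₀(1−t)w_0/(7K)}` — NO CONDITION
# LINKING `t` TO `p`; WITH THE EXACT HOT SAMPLER `Gap ≥ p·min{ct/(3m), (1−t)w_0/(7K)}` (lean-2 GEN-28, ours)

Venture-side (OURS).  Cell `lqcd-flow` (pub-lqcd), unit `pub-lqcd-lean-2-g28`, 2026-08-28.  Chapter N, file 2: the variance
inequality of `Scaling/MapStarRotation` (N1) read on the Dirichlet form of the chapter-M scheme
`P = t·ptGraphSwap μ (r ↦ (0, κ_r+1)) φ + (1−t)·prodKernel w M`.  Chapter M (`Scaling/DominatedStarGapAndMixing`, M8) has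
`γ⋆ ≥ tcp/(2m)` ONLY in the regime `4t ≤ p(1−t)w_0`, read off the distance profile; OPEN-MATH-chapterM items 1/5 ask what survives
without the regime.  For the quadratic theory the answer is: everything, at the rate `p·min{ct/(3m), γ₀(1−t)w_0/(7K)}` — the swap
budget `ct/m` and the refresh budget `(1−t)w_0/K` enter through a MINIMUM, never through a condition on their ratio.  (Chapter K's
`Scaling/FlowHubProposalLaw` had this for LEVEL maps with the constants `6` and `14`; the entry maps of chapter M are new, and the
exact bookkeeping `𝓔_P = t·𝓔_GSw + (1−t)·𝓔_Π` halves both constants.)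

## What is proved

* §1 **`ptGraph_dirichletForm_swap_eq_min`** — the swap Dirichlet form of ANY edge list with maps is EXACTLY
  `(2m)⁻¹·Σ_r Σ_x min{π̃(x), π̃(x^{(r)})}(F x − F x^{(r)})²` (N1's entry-swap energies); **`prodKernel_dirichletForm_ge_hot`** —
  `w_0·½Σ_xΣ_v π̃(x)M_0(x_0,v)(F x − F x^{0←v})² ≤ 𝓔_{Π_w^M}(F)`.
* §2 **`entryStar_poincare`** — `C·Var_π̃(f) ≤ 𝓔_P(f)` whenever `C·3m ≤ pct` and `C·(p + 6K) ≤ pγ₀(1−t)w_0`;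
  **`entryStar_spectralGap_ge`** — **`Gap(P) ≥ p·min{ct/(3m), γ₀(1−t)w_0/(7K)}`** (`K ≥ 1`, `p ≤ 1`, `|S| ≥ 2`; hot update
  `μ_0`-reversible with `γ₀·Var_{μ_0} ≤ 𝓔_{μ_0}(M_0)`, cold updates `μ_k`-reversible, otherwise arbitrary).
* §3 the exact hot sampler of chapter M (`M_0(u,·) = μ_0`, `γ₀ = 1`): `exactSampler_poincare_one`,
  **`dominatedStar_spectralGap_ge_regimeFree`** — `Gap ≥ p·min{ct/(3m), (1−t)w_0/(7K)}` under EXACTLY the hypotheses of M8 with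
  `4t ≤ p(1−t)w_0` replaced by `0 < t < 1`, `0 < w_0`; **`dominatedStar_spectralGap_ge_half`** — at the `p`-independent swap
  fraction `t = 1/2` and hot-only updates (`w_0 = 1`), `Gap ≥ p·min{c/(6m), 1/(14K)}`: OPEN-MATH item 5 for the variational gap.

Reading (no numerics implied): outside the regime the tag bookkeeping of chapter M stalls (a stale hub dirties clean partners faster
than it is refreshed), but the L² rate does not: it is the smaller of the rarest hub edge's proposal frequency `tc/m` times `p/3` and
the refresh frequency per cold level `(1−t)w_0/K` times `pγ₀/7`.  NOT CLAIMED: the distance profile / mixing time in total variation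
with a `log K` (that is OPEN-MATH item 1 and stays open; the spectral route gives `log(1/π̃_min)`, next files); the absolute gap
(next file); sharp constants; anything measured.  Literature grade (cell rule): OWN RESULT on N1 and the tree's Levin–Peres–Wilmer
Lemma 13.7 route (`le_spectralGap_of_poincare`); nothing cited as a fact; no new bib keys.
-/

noncomputable section

open Finset Function
open Literature.Probability.MarkovChains

namespace Summit.Ventures.LatticeQCDFlow.Scaling

variable {S : Type*} [Fintype S] [DecidableEq S] {K m : ℕ} {μ : Fin (K + 1) → S → ℝ} {M : Fin (K + 1) → S → S → ℝ}
  {w : Fin (K + 1) → ℝ} {t p : ℝ}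

/-! ## §1 The two energies of N1 on the Dirichlet form of the scheme -/

/-- **THE SWAP DIRICHLET FORM IS THE SUM OF THE ENTRY-SWAP ENERGIES:** for an edge list `e` with maps `φ` (distinct endpoints),
`𝓔_π̃(ptGraphSwap μ e φ; F) = (2m)⁻¹·Σ_r Σ_x min{π̃(x), π̃(x^{(r)})}(F x − F x^{(r)})²`, `x^{(r)} = edgeFlowSwap (φ r) i_r l_r x`. [ours] -/
theorem ptGraph_dirichletForm_swap_eq_min {e : Fin m → Fin (K + 1) × Fin (K + 1)} {φ : Fin m → Equiv.Perm S}
    (hμ : ∀ k x, 0 < μ k x) (he : ∀ r, (e r).1 ≠ (e r).2) (F : (Fin (K + 1) → S) → ℝ) :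
    dirichletForm (tensorFun μ) (ptGraphSwap μ e φ) F
      = 1 / (2 * m) * ∑ r : Fin m, ∑ x : Fin (K + 1) → S,
          min (tensorFun μ x) (tensorFun μ (edgeFlowSwap (φ r) (e r).1 (e r).2 x))
            * (F x - F (edgeFlowSwap (φ r) (e r).1 (e r).2 x)) ^ 2 := by
  have hpt : ∀ x y : Fin (K + 1) → S, tensorFun μ x * ptGraphSwap μ e φ x y * (F x - F y) ^ 2
      = ptGraphProposal e φ x y * (min (tensorFun μ x) (tensorFun μ y) * (F x - F y) ^ 2) := by
    intro x y
    by_cases hyx : y = x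
    · rw [hyx, sub_self]; simp
    · rw [tensorFun_mul_ptGraphSwap hμ he hyx]; ring
  have hrow : ∀ (x : Fin (K + 1) → S) (c : (Fin (K + 1) → S) → ℝ),
      ∑ y, ptGraphProposal e φ x y * c y = ∑ r : Fin m, 1 / m * c (edgeFlowSwap (φ r) (e r).1 (e r).2 x) := by
    intro x c
    unfold ptGraphProposal
    simp_rw [Finset.sum_mul]
    rw [Finset.sum_comm]
    refine sum_congr rfl fun r _ => ?_
    simp_rw [ite_mul, zero_mul]
    rw [Finset.sum_ite_eq' univ (edgeFlowSwap (φ r) (e r).1 (e r).2 x), if_pos (mem_univ _)]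
  unfold dirichletForm
  calc 1 / 2 * ∑ x, ∑ y, tensorFun μ x * ptGraphSwap μ e φ x y * (F x - F y) ^ 2
      = 1 / 2 * ∑ x, ∑ y, ptGraphProposal e φ x y * (min (tensorFun μ x) (tensorFun μ y) * (F x - F y) ^ 2) := by
        congr 1
        exact sum_congr rfl fun x _ => sum_congr rfl fun y _ => hpt x y
    _ = 1 / 2 * ∑ x, ∑ r : Fin m, 1 / m * (min (tensorFun μ x) (tensorFun μ (edgeFlowSwap (φ r) (e r).1 (e r).2 x))
          * (F x - F (edgeFlowSwap (φ r) (e r).1 (e r).2 x)) ^ 2) := by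
        congr 1
        exact sum_congr rfl fun x _ => hrow x (fun y => min (tensorFun μ x) (tensorFun μ y) * (F x - F y) ^ 2)
    _ = _ := by
        rw [Finset.sum_comm]
        simp_rw [← Finset.mul_sum]
        rw [← mul_assoc]
        congr 1
        ring

/-- **THE HOT COORDINATE OF THE PRODUCT UPDATE:** `w_0·½Σ_xΣ_v π̃(x)M_0(x_0,v)(F x − F x^{0←v})² ≤ 𝓔_π̃(Π_w^M; F)`
(`w ≥ 0`, `M_k ≥ 0`). [ours] -/
theorem prodKernel_dirichletForm_ge_hot (hμ : ∀ k x, 0 < μ k x) (hM : ∀ k, IsRowStochastic (M k)) (hw0 : ∀ k, 0 ≤ w k)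
    (F : (Fin (K + 1) → S) → ℝ) :
    w 0 * ((1 / 2) * ∑ x : Fin (K + 1) → S, ∑ v, tensorFun μ x * M 0 (x 0) v * (F x - F (update x 0 v)) ^ 2)
      ≤ dirichletForm (tensorFun μ) (prodKernel w M) F := by
  have hx : ∀ x : Fin (K + 1) → S, w 0 * ∑ v, tensorFun μ x * M 0 (x 0) v * (F x - F (update x 0 v)) ^ 2
      ≤ ∑ y, tensorFun μ x * prodKernel w M x y * (F x - F y) ^ 2 := by
    intro x
    have e : ∑ y, tensorFun μ x * prodKernel w M x y * (F x - F y) ^ 2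
        = tensorFun μ x * ∑ j, w j * ∑ v, M j (x j) v * (F x - F (update x j v)) ^ 2 := by
      simp_rw [mul_assoc]
      rw [← mul_sum, sum_prodKernel_mul M w x (fun y => (F x - F y) ^ 2)]
    rw [e]
    have hterm : ∀ j ∈ (univ : Finset (Fin (K + 1))), 0 ≤ w j * ∑ v, M j (x j) v * (F x - F (update x j v)) ^ 2 :=
      fun j _ => mul_nonneg (hw0 j) (sum_nonneg fun v _ => mul_nonneg ((hM j).1 _ _) (sq_nonneg _))
    have hsingle := Finset.single_le_sum hterm (mem_univ (0 : Fin (K + 1)))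
    calc w 0 * ∑ v, tensorFun μ x * M 0 (x 0) v * (F x - F (update x 0 v)) ^ 2
        = tensorFun μ x * (w 0 * ∑ v, M 0 (x 0) v * (F x - F (update x 0 v)) ^ 2) := by
          simp only [Finset.mul_sum]
          exact sum_congr rfl fun v _ => by ring
      _ ≤ tensorFun μ x * ∑ j, w j * ∑ v, M j (x j) v * (F x - F (update x j v)) ^ 2 :=
          mul_le_mul_of_nonneg_left hsingle (tensorFun_pos hμ x).le
  unfold dirichletForm
  rw [← mul_assoc, mul_comm (w 0) (1 / 2), mul_assoc, mul_sum]
  exact mul_le_mul_of_nonneg_left (sum_le_sum fun x _ => hx x) (by norm_num)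

section EntryStar
variable (κ : Fin m → Fin K) (φ : Fin m → Equiv.Perm S)

/-! ## §2 The regime-free Poincaré inequality and spectral gap -/

/-- **THE REGIME-FREE POINCARÉ INEQUALITY OF THE MAP-ASSISTED HUB.**  Hub list `r ↦ (0, κ_r+1)` with entry maps `φ_r`
(`m ≥ 1`), positive unit-mass laws `μ_k`, update weights `w ≥ 0` with `w_0 > 0`, `0 < t < 1`, cold updates ARBITRARY transition
matrices, hot update with `γ₀·Var_{μ_0}(h) ≤ 𝓔_{μ_0}(M_0; h)`, transported one-sided domination `p·μ_{κ_r+1}(φ_r u) ≤ μ_0(u)`, every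
cold level listed `≥ c ≥ 1` times.  Then `C·Var_π̃(f) ≤ 𝓔_π̃(P; f)` for every `f` and every `C ≥ 0` with `C·3m ≤ pct` and
`C·(p + 6K) ≤ pγ₀(1−t)w_0` — NO condition linking `t` to `p`. [ours] -/
theorem entryStar_poincare (hm : 1 ≤ m) (hμ : ∀ k x, 0 < μ k x) (hμ1 : ∀ k, ∑ u, μ k u = 1)
    (hM : ∀ k, IsRowStochastic (M k)) (hw0 : ∀ k, 0 ≤ w k) (hwhot : 0 < w 0) (ht0 : 0 < t) (ht1 : t < 1)
    {γ₀ : ℝ} (hp : 0 < p) (hγ₀ : 0 < γ₀) (hdom : ∀ (r : Fin m) (u : S), p * μ (κ r).succ (φ r u) ≤ μ 0 u)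
    (hgap0 : ∀ h : S → ℝ, γ₀ * lawVariance (μ 0) h ≤ dirichletForm (μ 0) (M 0) h)
    {c : ℕ} (hc1 : 1 ≤ c) (hc : ∀ k : Fin K, c ≤ (univ.filter (fun r : Fin m => κ r = k)).card)
    (f : (Fin (K + 1) → S) → ℝ) {C : ℝ} (hC0 : 0 ≤ C) (hC1 : C * (3 * m) ≤ p * c * t)
    (hC2 : C * (p + 6 * K) ≤ p * γ₀ * (1 - t) * w 0) :
    C * lawVariance (tensorFun μ) f ≤ dirichletForm (tensorFun μ) (fun y z : Fin (K + 1) → S =>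
        t * ptGraphSwap μ (fun r : Fin m => (((0 : Fin (K + 1)), (κ r).succ) : Fin (K + 1) × Fin (K + 1))) φ y z
          + (1 - t) * prodKernel w M y z) f := by
  have hmpos : (0 : ℝ) < m := Nat.cast_pos.mpr (by omega)
  have hcpos : (0 : ℝ) < c := Nat.cast_pos.mpr (by omega)
  have h1t : 0 < 1 - t := by linarith
  have hW0 : ∀ z, 0 ≤ tensorFun μ z := fun z => (tensorFun_pos hμ z).le
  -- the energies
  set V : ℝ := ∑ z : Fin (K + 1) → S, ∑ v, tensorFun μ z * μ 0 v * (f z - f (update z 0 v)) ^ 2 with hV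
  set T : ℝ := ∑ r : Fin m, ∑ x : Fin (K + 1) → S,
    min (tensorFun μ x) (tensorFun μ (edgeFlowSwap (φ r) 0 (κ r).succ x))
      * (f x - f (edgeFlowSwap (φ r) 0 (κ r).succ x)) ^ 2 with hT
  set U : ℝ := ∑ x : Fin (K + 1) → S, ∑ v, tensorFun μ x * M 0 (x 0) v * (f x - f (update x 0 v)) ^ 2 with hU
  set A : ℝ := dirichletForm (tensorFun μ)
    (ptGraphSwap μ (fun r : Fin m => (((0 : Fin (K + 1)), (κ r).succ) : Fin (K + 1) × Fin (K + 1))) φ) f with hA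
  set B : ℝ := dirichletForm (tensorFun μ) (prodKernel w M) f with hB
  have hV0 : 0 ≤ V := sum_nonneg fun z _ => sum_nonneg fun v _ => mul_nonneg (mul_nonneg (hW0 z) (hμ _ _).le) (sq_nonneg _)
  have hT0 : 0 ≤ T := sum_nonneg fun r _ => sum_nonneg fun x _ => mul_nonneg (le_min (hW0 _) (hW0 _)) (sq_nonneg _)
  have hp0 : p ≠ 0 := hp.ne'
  have hc0 : (c : ℝ) ≠ 0 := hcpos.ne'
  have hm0 : (m : ℝ) ≠ 0 := hmpos.ne'
  have hγ0 : γ₀ ≠ 0 := hγ₀.ne'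
  -- N1: the chain-free variance inequality
  have hN1 : lawVariance (tensorFun μ) f ≤ (1 / 2 + 3 * K / p) * V + 3 / (2 * p * c) * T :=
    mapStar_variance_le hμ hμ1 hp κ φ hdom hc1 hc f
  -- §1: the swap Dirichlet form is `T/(2m)`, the product update carries `w_0·U/2`
  have hswap : A = 1 / (2 * m) * T :=
    ptGraph_dirichletForm_swap_eq_min
      (e := fun r : Fin m => (((0 : Fin (K + 1)), (κ r).succ) : Fin (K + 1) × Fin (K + 1))) (φ := φ) hμ
      (fun r => (Fin.succ_ne_zero (κ r)).symm) f
  have hhot : w 0 * (1 / 2 * U) ≤ B := prodKernel_dirichletForm_ge_hot hμ hM hw0 f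
  have hVU : V ≤ 1 / γ₀ * U := star_hot_variance_le hμ1 (fun k u => (hμ k u).le) hγ₀ hgap0 f
  have hsplit : dirichletForm (tensorFun μ) (fun y z : Fin (K + 1) → S =>
        t * ptGraphSwap μ (fun r : Fin m => (((0 : Fin (K + 1)), (κ r).succ) : Fin (K + 1) × Fin (K + 1))) φ y z
          + (1 - t) * prodKernel w M y z) f = t * A + (1 - t) * B :=
    weightedScheme_dirichletForm t f
  -- the swap budget
  have k2 : C * (3 / (2 * p * c) * T) ≤ t * A := by
    rw [hswap]
    have h1 : C * (3 / (2 * p * c) * T) = (C * (3 * m)) / (p * c) * (T / (2 * m)) := by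
      field_simp
    have h2 : t * (1 / (2 * m) * T) = (p * c * t) / (p * c) * (T / (2 * m)) := by
      field_simp
    rw [h1, h2]
    exact mul_le_mul_of_nonneg_right (div_le_div_of_nonneg_right hC1 (by positivity)) (by positivity)
  -- the refresh budget
  have k1 : C * ((1 / 2 + 3 * K / p) * V) ≤ (1 - t) * B := by
    have hU : γ₀ * V ≤ U := by
      have h := mul_le_mul_of_nonneg_left hVU hγ₀.le
      rwa [← mul_assoc, mul_one_div_cancel hγ0, one_mul] at h
    have hB2 : w 0 * U ≤ 2 * B := by linarith [hhot]
    have h5 := mul_le_mul_of_nonneg_left hU hwhot.le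
    have hVB : γ₀ * w 0 * V ≤ 2 * B := by linarith [h5, hB2]
    have h3 : C * (p + 6 * K) * V ≤ p * γ₀ * (1 - t) * w 0 * V := mul_le_mul_of_nonneg_right hC2 hV0
    have h4 : p * γ₀ * (1 - t) * w 0 * V ≤ p * (1 - t) * (2 * B) := by
      have h := mul_le_mul_of_nonneg_left hVB (mul_nonneg hp.le h1t.le)
      linarith [h]
    have e : C * ((1 / 2 + 3 * K / p) * V) = C * (p + 6 * K) * V / (2 * p) := by
      field_simp
      ring
    rw [e, div_le_iff₀ (by positivity)]
    linarith [h3, h4]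
  calc C * lawVariance (tensorFun μ) f ≤ C * ((1 / 2 + 3 * K / p) * V + 3 / (2 * p * c) * T) :=
        mul_le_mul_of_nonneg_left hN1 hC0
    _ = C * ((1 / 2 + 3 * K / p) * V) + C * (3 / (2 * p * c) * T) := by ring
    _ ≤ (1 - t) * B + t * A := add_le_add k1 k2
    _ = _ := by rw [hsplit]; ring

/-- **THE REGIME-FREE SPECTRAL GAP: `Gap(P) ≥ p·min{ct/(3m), γ₀(1−t)w_0/(7K)}`** (`K ≥ 1`, `p ≤ 1`, `|S| ≥ 2`; hot update
`μ_0`-reversible with Poincaré constant `γ₀`, cold updates `μ_k`-reversible) — no condition linking the swap fraction to the transport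
quality. [ours] -/
theorem entryStar_spectralGap_ge [Nontrivial S] (hK : 1 ≤ K) (hm : 1 ≤ m) (hμ : ∀ k x, 0 < μ k x) (hμ1 : ∀ k, ∑ u, μ k u = 1)
    (hM : ∀ k, IsRowStochastic (M k)) (hMrev : ∀ k, DetailedBalance (μ k) (M k)) (hw0 : ∀ k, 0 ≤ w k)
    (hw1 : ∑ k, w k = 1) (hwhot : 0 < w 0) (ht0 : 0 < t) (ht1 : t < 1) {γ₀ : ℝ} (hp : 0 < p) (hp1 : p ≤ 1)
    (hγ₀ : 0 < γ₀) (hdom : ∀ (r : Fin m) (u : S), p * μ (κ r).succ (φ r u) ≤ μ 0 u)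
    (hgap0 : ∀ h : S → ℝ, γ₀ * lawVariance (μ 0) h ≤ dirichletForm (μ 0) (M 0) h)
    {c : ℕ} (hc1 : 1 ≤ c) (hc : ∀ k : Fin K, c ≤ (univ.filter (fun r : Fin m => κ r = k)).card) :
    p * min (c * t / (3 * m)) (γ₀ * (1 - t) * w 0 / (7 * K))
      ≤ spectralGap (tensorFun μ) (fun y z : Fin (K + 1) → S =>
          t * ptGraphSwap μ (fun r : Fin m => (((0 : Fin (K + 1)), (κ r).succ) : Fin (K + 1) × Fin (K + 1))) φ y z
            + (1 - t) * prodKernel w M y z) := by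
  have hKr : (1 : ℝ) ≤ K := by exact_mod_cast hK
  have hmpos : (0 : ℝ) < m := Nat.cast_pos.mpr (by omega)
  have hcpos : (0 : ℝ) < c := Nat.cast_pos.mpr (by omega)
  have h1t : 0 < 1 - t := by linarith
  have hm0 : (m : ℝ) ≠ 0 := hmpos.ne'
  have hK0 : (K : ℝ) ≠ 0 := by positivity
  set m₀ := min (c * t / (3 * m)) (γ₀ * (1 - t) * w 0 / (7 * K)) with hm₀
  refine le_spectralGap_of_poincare (tensorFun_pos hμ) (sum_tensorFun_eq_one μ hμ1)
    (weightedScheme_isRowStochastic (ptGraphSwap_isRowStochastic hμ) hM hw0 hw1 ht0.le ht1.le)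
    (weightedScheme_detailedBalance (ptGraphSwap_detailedBalance hμ) hMrev t) fun f => ?_
  refine entryStar_poincare κ φ hm hμ hμ1 hM hw0 hwhot ht0 ht1 hp hγ₀ hdom hgap0 hc1 hc f
    (mul_nonneg hp.le (le_min (by positivity) (by positivity))) ?_ ?_
  · have h1 : m₀ ≤ c * t / (3 * m) := min_le_left _ _
    calc p * m₀ * (3 * m) ≤ p * (c * t / (3 * m)) * (3 * m) :=
          mul_le_mul_of_nonneg_right (mul_le_mul_of_nonneg_left h1 hp.le) (by positivity)
      _ = p * c * t := by field_simp
  · have h2 : m₀ ≤ γ₀ * (1 - t) * w 0 / (7 * K) := min_le_right _ _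
    have h3 : (p + 6 * (K : ℝ)) ≤ 7 * K := by nlinarith
    have h4 : m₀ * (p + 6 * K) ≤ γ₀ * (1 - t) * w 0 / (7 * K) * (7 * K) :=
      mul_le_mul h2 h3 (by positivity) (by positivity)
    calc p * m₀ * (p + 6 * K) = p * (m₀ * (p + 6 * K)) := by ring
      _ ≤ p * (γ₀ * (1 - t) * w 0 / (7 * K) * (7 * K)) := mul_le_mul_of_nonneg_left h4 hp.le
      _ = p * γ₀ * (1 - t) * w 0 := by field_simp

/-! ## §3 The exact hot sampler of chapter M -/

omit [DecidableEq S] in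
/-- The exact hot sampler `M_0(u,·) = μ_0` has Poincaré constant `1`: `𝓔_{μ_0}(M_0; h) = Var_{μ_0}(h)`. [ours] -/
theorem exactSampler_poincare_one [DecidableEq S] (hμ1 : ∑ u, μ 0 u = 1) (hM0 : ∀ u v, M 0 u v = μ 0 v) (h : S → ℝ) :
    1 * lawVariance (μ 0) h ≤ dirichletForm (μ 0) (M 0) h := by
  have e : dirichletForm (μ 0) (M 0) h = dirichletForm (μ 0) (limitMatrix (μ 0)) h := by
    unfold dirichletForm limitMatrix
    simp only [Matrix.of_apply, hM0]
  rw [one_mul, e, dirichletForm_limitMatrix hμ1]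

/-- **THE REGIME-FREE GAP OF THE CHAPTER-M SCHEME: `Gap ≥ p·min{ct/(3m), (1−t)w_0/(7K)}`** — exact hot sampler, one-sided
domination `p·μ_{κ_r+1}(φ_r u) ≤ μ_0(u)` (`0 < p ≤ 1`), reversible cold kernels, hub multiplicities `≥ c ≥ 1`, `0 < t < 1`,
`w_0 > 0`: the hypotheses of `dominatedStar_absSpectralGap_ge` (M8) with `4t ≤ p(1−t)w_0` REMOVED. [ours] -/
theorem dominatedStar_spectralGap_ge_regimeFree [Nontrivial S] (hK : 1 ≤ K) (hm : 1 ≤ m) (ht0 : 0 < t) (ht1 : t < 1)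
    (hw0 : ∀ k, 0 ≤ w k) (hw00 : 0 < w 0) (hw1 : ∑ k, w k = 1) (hμ : ∀ k x, 0 < μ k x)
    (hμ1 : ∀ k, ∑ u, μ k u = 1) (hM : ∀ k, IsRowStochastic (M k)) (hMrev : ∀ k, DetailedBalance (μ k) (M k))
    (hM0 : ∀ u v, M 0 u v = μ 0 v) (hp0 : 0 < p) (hp1 : p ≤ 1) (hdom : ∀ r u, p * μ (κ r).succ (φ r u) ≤ μ 0 u)
    {c : ℕ} (hc1 : 1 ≤ c) (hc : ∀ p' : Fin K, c ≤ (univ.filter (fun r : Fin m => κ r = p')).card) :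
    p * min (c * t / (3 * m)) ((1 - t) * w 0 / (7 * K))
      ≤ spectralGap (tensorFun μ) (fun y z : Fin (K + 1) → S =>
          t * ptGraphSwap μ (fun r : Fin m => (((0 : Fin (K + 1)), (κ r).succ) : Fin (K + 1) × Fin (K + 1))) φ y z
            + (1 - t) * prodKernel w M y z) := by
  have h := entryStar_spectralGap_ge κ φ hK hm hμ hμ1 hM hMrev hw0 hw1 hw00 ht0 ht1 hp0 hp1 one_pos hdom
    (exactSampler_poincare_one (hμ1 0) hM0) hc1 hc
  simpa only [one_mul] using h

/-- **OPEN-MATH item 5, for the gap: at the `p`-INDEPENDENT swap fraction `t = 1/2`, `Gap ≥ p·min{c/(6m), w_0/(14K)}`**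
(exact hot sampler; e.g. `w_0 = 1`, hot-only updates, `m = cK`: `Gap ≥ p/(14K)`, relaxation `≤ 14K/p` swap attempts' worth —
linear in `1/p`, where the regime `4t ≤ p(1−t)w_0` of chapter M forced `t = Θ(p)` and a rate `Θ(p²c/m)`). [ours] -/
theorem dominatedStar_spectralGap_ge_half [Nontrivial S] (hK : 1 ≤ K) (hm : 1 ≤ m) (hw0 : ∀ k, 0 ≤ w k) (hw00 : 0 < w 0)
    (hw1 : ∑ k, w k = 1) (hμ : ∀ k x, 0 < μ k x) (hμ1 : ∀ k, ∑ u, μ k u = 1) (hM : ∀ k, IsRowStochastic (M k))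
    (hMrev : ∀ k, DetailedBalance (μ k) (M k)) (hM0 : ∀ u v, M 0 u v = μ 0 v) (hp0 : 0 < p) (hp1 : p ≤ 1)
    (hdom : ∀ r u, p * μ (κ r).succ (φ r u) ≤ μ 0 u)
    {c : ℕ} (hc1 : 1 ≤ c) (hc : ∀ p' : Fin K, c ≤ (univ.filter (fun r : Fin m => κ r = p')).card) :
    p * min ((c : ℝ) / (6 * m)) (w 0 / (14 * K))
      ≤ spectralGap (tensorFun μ) (fun y z : Fin (K + 1) → S =>
          (1 / 2 : ℝ) * ptGraphSwap μ (fun r : Fin m => (((0 : Fin (K + 1)), (κ r).succ) : Fin (K + 1) × Fin (K + 1))) φ y z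
            + (1 - 1 / 2) * prodKernel w M y z) := by
  have h := dominatedStar_spectralGap_ge_regimeFree κ φ hK hm (t := 1 / 2) (by norm_num) (by norm_num) hw0 hw00 hw1 hμ hμ1
    hM hMrev hM0 hp0 hp1 hdom hc1 hc
  have e : min ((c : ℝ) / (6 * m)) (w 0 / (14 * K)) = min ((c : ℝ) * (1 / 2) / (3 * m)) ((1 - 1 / 2) * w 0 / (7 * K)) := by
    congr 1 <;> ring
  rw [e]
  exact h

end EntryStar

end Summit.Ventures.LatticeQCDFlow.Scaling

end
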